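import Mathlib
import HarnessLib
import Summits.ABC.ABC.Theorems.ReceptacleIdentity.Negative.TameLocalReceptacleResidueFreeLemmas

/-!
# Arithmetic of the three-triple certificate (crux stmt-ABC-14354, line SketchIdeator1)

The arithmetic of the three-triple certificate `T⁻ = (x, y, 15u)`, `T₁⁺ = (x, Y, 16u)`,
`T₂⁺ = (X, y, 15W)` — registered stub of crux stmt-ABC-14354, line SketchIdeator1; Steps 1–4 of
`ReceptacleIdentity.Negative.tameLocal_residueFree_false` re-packaged as an existence statement
(primes `r, q, s`, the members, their sizes, positivity and coprimality).
-/

-- `Summit.<Summit>.<Problem>` is the mandated summit-side namespace (CONVENTIONS §2); for the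
-- single-conjunct summit `ABC` the two coincide, so the duplicate `ABC.ABC` is deliberate.
set_option linter.dupNamespace false

namespace Summit.ABC.ABC.Theorems.TameLocalReceptacle

open Summit.ABC.ABC.Theorems.ReceptacleIdentity.Negative

/-- **Three-triple certificate, arithmetic part.** For every `R₀` there are primes `r ≥ max R₀ 7`,
`r < q ≤ 2r` (Bertrand) and `s`, with `X = r⁴`, `W = q⁴`, `y = 15W − X` (even, `≡ −1 mod 15`),
`s ∤ y` and `2y < Y = s⁴ ≤ 2²¹ y` (one of four Bertrand primes above `(2y)^{1/4}`), `u = Y − y` (odd,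
prime to `15`), `x = 15u − y`, such that the members of the triples `T⁻ = (x, y, 15u)`,
`T₁⁺ = (x, Y, 16u)`, `T₂⁺ = (X, y, 15W)` are positive, pairwise coprime within each triple, and
balanced (`14W ≤ y`, `W ≤ 16X`, `u ≤ 2²¹ y`, `14u ≤ x`). [folklore] -/
theorem stub_certificate (R₀ : ℕ) : ∃ r q s X W y Y u x : ℕ,
    R₀ ≤ r ∧ 7 ≤ r ∧ r.Prime ∧ q.Prime ∧ s.Prime ∧ r < q ∧ q ≤ 2 * r ∧
    X = r ^ 4 ∧ W = q ^ 4 ∧ Y = s ^ 4 ∧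
    y + X = 15 * W ∧ u + y = Y ∧ x + y = 15 * u ∧ x + Y = 16 * u ∧
    14 * W ≤ y ∧ W ≤ 16 * X ∧ 2 * y < Y ∧ Y ≤ 2 ^ 21 * y ∧ u ≤ 2 ^ 21 * y ∧ 14 * u ≤ x ∧
    0 < X ∧ 0 < W ∧ 0 < Y ∧ 0 < y ∧ 0 < u ∧ 0 < x ∧
    Nat.Coprime x y ∧ Nat.Coprime x Y ∧ Nat.Coprime X y ∧
    Nat.Coprime 15 u ∧ Nat.Coprime 16 u ∧ Nat.Coprime 15 W ∧
    Nat.Coprime x (15 * u) ∧ Nat.Coprime y (15 * u) ∧ Nat.Coprime x (16 * u) ∧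
    Nat.Coprime Y (16 * u) ∧ Nat.Coprime X (15 * W) ∧ Nat.Coprime y (15 * W) := by
  -- adapted from `ReceptacleIdentity.Negative.tameLocal_residueFree_false`, Steps 1–4
  -- Step 1: a prime r ≥ max R₀ 7, prime to 2, 3, 5
  obtain ⟨r, hrge, hr⟩ := Nat.exists_infinite_primes (max R₀ 7)
  have hrR : R₀ ≤ r := le_trans (le_max_left _ _) hrge
  have hr7 : 7 ≤ r := le_trans (le_max_right _ _) hrge
  have hr2 : ¬ 2 ∣ r := fun h => by
    have := (Nat.prime_dvd_prime_iff_eq Nat.prime_two hr).mp h; omega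
  have hr3 : ¬ 3 ∣ r := fun h => by
    have := (Nat.prime_dvd_prime_iff_eq Nat.prime_three hr).mp h; omega
  have hr5 : ¬ 5 ∣ r := fun h => by
    have := (Nat.prime_dvd_prime_iff_eq (by norm_num) hr).mp h; omega
  -- Step 2: a Bertrand prime q with r < q ≤ 2r
  obtain ⟨q, hq, hrq, hq2r⟩ := Nat.exists_prime_lt_and_le_two_mul r (by omega)
  have hq2 : ¬ 2 ∣ q := fun h => by
    have := (Nat.prime_dvd_prime_iff_eq Nat.prime_two hq).mp h; omega
  -- X = r⁴, W = q⁴, y = 15 W − X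
  set X : ℕ := r ^ 4 with hX
  set W : ℕ := q ^ 4 with hW
  have hX0 : 0 < X := pow_pos (by omega) 4
  have hXW : X < W := Nat.pow_lt_pow_left hrq (by norm_num)
  have hW16 : W ≤ 16 * X := by
    calc W = q ^ 4 := rfl
      _ ≤ (2 * r) ^ 4 := Nat.pow_le_pow_left hq2r 4
      _ = 16 * r ^ 4 := by ring
  have hX2 : X % 2 = 1 := by
    rw [hX, Nat.pow_mod]; have e : r % 2 = 1 := by omega
    rw [e]
  have hW2 : W % 2 = 1 := by
    rw [hW, Nat.pow_mod]; have e : q % 2 = 1 := by omega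
    rw [e]
  have hX3 : X % 3 = 1 := pow_four_mod_three hr3
  have hX5 : X % 5 = 1 := pow_four_mod_five hr5
  obtain ⟨y, hyX⟩ : ∃ y : ℕ, y + X = 15 * W := ⟨15 * W - X, Nat.sub_add_cancel (by omega)⟩
  have hy14 : 14 * W ≤ y := by omega
  have hy0 : 0 < y := by omega
  have hy2 : y % 2 = 0 := by omega
  have hy3 : y % 3 = 2 := by omega
  have hy5 : y % 5 = 4 := by omega
  -- Step 3: a prime s ∤ y with 2y < s⁴ ≤ 2²¹ y
  obtain ⟨hn4, hn32⟩ := fourth_root_bounds hy0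
  set n₀ : ℕ := Nat.sqrt (Nat.sqrt (2 * y)) + 1 with hn₀
  have hn₀2 : 2 ≤ n₀ := by
    have h1 : 1 ≤ Nat.sqrt (2 * y) := by rw [Nat.le_sqrt]; omega
    have h2 : 1 ≤ Nat.sqrt (Nat.sqrt (2 * y)) := by rw [Nat.le_sqrt]; omega
    omega
  obtain ⟨s, hs, hns, hs16, hsy⟩ := exists_prime_not_dvd hy0 hn4 (by omega)
  have hs2 : ¬ 2 ∣ s := fun h => by
    have := (Nat.prime_dvd_prime_iff_eq Nat.prime_two hs).mp h; omega
  set Y : ℕ := s ^ 4 with hY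
  have hyY : 2 * y < Y :=
    lt_of_lt_of_le hn4 (Nat.pow_le_pow_left hns.le 4)
  have hY21 : Y ≤ 2 ^ 21 * y := by
    calc Y = s ^ 4 := rfl
      _ ≤ (16 * n₀) ^ 4 := Nat.pow_le_pow_left hs16 4
      _ = 2 ^ 16 * n₀ ^ 4 := by ring
      _ ≤ 2 ^ 16 * (32 * y) := by gcongr
      _ = 2 ^ 21 * y := by ring
  have hY2 : Y % 2 = 1 := by
    rw [hY, Nat.pow_mod]; have e : s % 2 = 1 := by omega
    rw [e]
  have hY3 : Y % 3 ≠ 2 := pow_four_mod_three_ne_two s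
  have hY5 : Y % 5 ≤ 1 := pow_four_mod_five_le_one s
  -- u = Y − y, x = 15 u − y
  obtain ⟨u, hu⟩ : ∃ u : ℕ, u + y = Y := ⟨Y - y, Nat.sub_add_cancel (by omega)⟩
  have hyu : y < u := by omega
  have hu21 : u ≤ 2 ^ 21 * y := by omega
  have hu2 : u % 2 = 1 := by omega
  have hu3 : u % 3 ≠ 0 := by omega
  have hu5 : u % 5 ≠ 0 := by omega
  obtain ⟨x, hx⟩ : ∃ x : ℕ, x + y = 15 * u := ⟨15 * u - y, Nat.sub_add_cancel (by omega)⟩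
  have hx14 : 14 * u ≤ x := by omega
  have hx0 : 0 < x := by omega
  have hu0 : 0 < u := by omega
  have hxY : x + Y = 16 * u := by omega
  -- Step 4: coprimality
  have cop_s_y : Nat.Coprime s y := (Nat.Prime.coprime_iff_not_dvd hs).mpr hsy
  have cop_Y_y : Nat.Coprime Y y := Nat.Coprime.pow_left 4 cop_s_y
  have cop_u_y : Nat.Coprime u y := Nat.coprime_add_self_left.mp (by rw [hu]; exact cop_Y_y)
  have h3y : ¬ 3 ∣ y := by omega
  have h5y : ¬ 5 ∣ y := by omega
  have cop_15_y : Nat.Coprime 15 y :=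
    Nat.Coprime.mul_left ((Nat.Prime.coprime_iff_not_dvd Nat.prime_three).mpr h3y)
      ((Nat.Prime.coprime_iff_not_dvd (by norm_num)).mpr h5y)
  have cop_15u_y : Nat.Coprime (15 * u) y := Nat.Coprime.mul_left cop_15_y cop_u_y
  have cop_x_y : Nat.Coprime x y := Nat.coprime_add_self_left.mp (by rw [hx]; exact cop_15u_y)
  -- ¬ s ∣ x, hence gcd(x, Y) = 1
  have hsx : ¬ s ∣ x := by
    intro h
    have h16 : s ∣ 16 * u := by rw [← hxY]; exact dvd_add h (dvd_pow_self s (by norm_num))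
    have cop_s_16 : Nat.Coprime s 16 := by
      have e : (16 : ℕ) = 2 ^ 4 := by norm_num
      rw [e]; exact Nat.Coprime.pow_right 4 ((Nat.coprime_primes hs Nat.prime_two).mpr (by omega))
    have hsu : s ∣ u := cop_s_16.dvd_of_dvd_mul_left h16
    have hsY : s ∣ u + y := by rw [hu]; exact dvd_pow_self s (by norm_num)
    exact hsy ((Nat.dvd_add_right hsu).mp hsY)
  have cop_x_Y : Nat.Coprime x Y :=
    (Nat.Coprime.pow_left 4 ((Nat.Prime.coprime_iff_not_dvd hs).mpr hsx)).symm
  -- ¬ r ∣ y, hence gcd(X, y) = 1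
  have hry : ¬ r ∣ y := by
    intro h
    have h15 : r ∣ 15 * W := by rw [← hyX]; exact dvd_add h (dvd_pow_self r (by norm_num))
    rcases (Nat.Prime.dvd_mul hr).mp h15 with h1 | h1
    · have h35 : r ∣ 3 * 5 := by simpa using h1
      rcases (Nat.Prime.dvd_mul hr).mp h35 with h2 | h2
      · have := (Nat.prime_dvd_prime_iff_eq hr Nat.prime_three).mp h2; omega
      · have := (Nat.prime_dvd_prime_iff_eq hr (by norm_num)).mp h2; omega
    · have := (Nat.prime_dvd_prime_iff_eq hr hq).mp (hr.dvd_of_dvd_pow h1); omega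
  have cop_X_y : Nat.Coprime X y := Nat.Coprime.pow_left 4 ((Nat.Prime.coprime_iff_not_dvd hr).mpr hry)
  -- auxiliary coprimalities of the third members
  have h3u : ¬ 3 ∣ u := by omega
  have h5u : ¬ 5 ∣ u := by omega
  have h2u : ¬ 2 ∣ u := by omega
  have cop_15_u : Nat.Coprime 15 u :=
    Nat.Coprime.mul_left ((Nat.Prime.coprime_iff_not_dvd Nat.prime_three).mpr h3u)
      ((Nat.Prime.coprime_iff_not_dvd (by norm_num)).mpr h5u)
  have cop_16_u : Nat.Coprime 16 u := by
    have e : (16 : ℕ) = 2 ^ 4 := by norm_num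
    rw [e]; exact Nat.Coprime.pow_left 4 ((Nat.Prime.coprime_iff_not_dvd Nat.prime_two).mpr h2u)
  have cop_15_W : Nat.Coprime 15 W :=
    Nat.Coprime.mul_left
      (Nat.Coprime.pow_right 4 ((Nat.coprime_primes Nat.prime_three hq).mpr (by omega)))
      (Nat.Coprime.pow_right 4 ((Nat.coprime_primes (by norm_num : Nat.Prime 5) hq).mpr (by omega)))
  have cop_x_15u : Nat.Coprime x (15 * u) := by
    rw [← hx]; exact Nat.coprime_self_add_right.mpr cop_x_y
  have cop_y_15u : Nat.Coprime y (15 * u) := by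
    rw [← hx]; exact Nat.coprime_add_self_right.mpr cop_x_y.symm
  have cop_x_16u : Nat.Coprime x (16 * u) := by
    rw [← hxY]; exact Nat.coprime_self_add_right.mpr cop_x_Y
  have cop_Y_16u : Nat.Coprime Y (16 * u) := by
    rw [← hxY]; exact Nat.coprime_add_self_right.mpr cop_x_Y.symm
  have cop_X_15W : Nat.Coprime X (15 * W) := by
    rw [← hyX, add_comm]; exact Nat.coprime_self_add_right.mpr cop_X_y
  have cop_y_15W : Nat.Coprime y (15 * W) := by
    rw [← hyX]; exact Nat.coprime_self_add_right.mpr cop_X_y.symm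
  -- positivity of the members
  have hW0 : 0 < W := by omega
  have hY0 : 0 < Y := by omega
  exact ⟨r, q, s, X, W, y, Y, u, x, hrR, hr7, hr, hq, hs, hrq, hq2r, hX, hW, hY, hyX, hu, hx, hxY,
    hy14, hW16, hyY, hY21, hu21, hx14, hX0, hW0, hY0, hy0, hu0, hx0, cop_x_y, cop_x_Y, cop_X_y,
    cop_15_u, cop_16_u, cop_15_W, cop_x_15u, cop_y_15u, cop_x_16u, cop_Y_16u, cop_X_15W, cop_y_15W⟩

end Summit.ABC.ABC.Theorems.TameLocalReceptacle
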